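import Summits.HubbardSuperconductivity.HubbardSuperconductivity.Theorems.AnisotropyChordTransferFibre3FinXBNine
import Summits.HubbardSuperconductivity.HubbardSuperconductivity.Theorems.AnisotropyChordTransferFibre3FinXBTen
import Summits.HubbardSuperconductivity.HubbardSuperconductivity.Theorems.AnisotropyChordTransferFibre3FinXBEleven
import Summits.HubbardSuperconductivity.HubbardSuperconductivity.Theorems.AnisotropyChordTransferFibre3FinXBTwelve
import Summits.HubbardSuperconductivity.HubbardSuperconductivity.Theorems.AnisotropyChordTransferFibre3FinXBThirteen
import Summits.HubbardSuperconductivity.HubbardSuperconductivity.Theorems.AnisotropyChordTransferFibre3FinXBFourteen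
import Summits.HubbardSuperconductivity.HubbardSuperconductivity.Theorems.AnisotropyChordTransferFibre3FinXBFifteen
import Summits.HubbardSuperconductivity.HubbardSuperconductivity.Theorems.AnisotropyChordTransferFibre3FinXBSixteen
import Summits.HubbardSuperconductivity.HubbardSuperconductivity.Theorems.AnisotropyChordTransferFibre3FinXBSeventeen
import Summits.HubbardSuperconductivity.HubbardSuperconductivity.Theorems.AnisotropyChordTransferFibre3FinXBEighteen
import Summits.HubbardSuperconductivity.HubbardSuperconductivity.Theorems.AnisotropyChordTransferFibre3FinXBNineteen
import Summits.HubbardSuperconductivity.HubbardSuperconductivity.Theorems.AnisotropyChordTransferFibre3FinXBTwenty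
import Summits.HubbardSuperconductivity.HubbardSuperconductivity.Theorems.AnisotropyChordTransferFibre3FinXBTwentyOne
import Summits.HubbardSuperconductivity.HubbardSuperconductivity.Theorems.AnisotropyChordTransferFibre3FinXBTwentyTwo
import Summits.HubbardSuperconductivity.HubbardSuperconductivity.Theorems.AnisotropyChordTransferFibre3FinXBTwentyThree
import Summits.HubbardSuperconductivity.HubbardSuperconductivity.Theorems.AnisotropyChordTransferFibre3FinXBTwentyFour
import Summits.HubbardSuperconductivity.HubbardSuperconductivity.Theorems.AnisotropyChordTransferFibre3FinXB2TwentyFive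
import Summits.HubbardSuperconductivity.HubbardSuperconductivity.Theorems.AnisotropyChordTransferFibre3FinXB2TwentySix
import Summits.HubbardSuperconductivity.HubbardSuperconductivity.Theorems.AnisotropyChordTransferFibre3FinXB2TwentySeven
import Summits.HubbardSuperconductivity.HubbardSuperconductivity.Theorems.AnisotropyChordTransferFibre3FinXB2TwentyEight
import Summits.HubbardSuperconductivity.HubbardSuperconductivity.Theorems.AnisotropyChordTransferFibre3FinXB2TwentyNine
import Summits.HubbardSuperconductivity.HubbardSuperconductivity.Theorems.AnisotropyChordTransferFibre3FinXB2Thirty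
import Summits.HubbardSuperconductivity.HubbardSuperconductivity.Theorems.AnisotropyChordTransferFibre3FinXB2ThirtyOne
import Summits.HubbardSuperconductivity.HubbardSuperconductivity.Theorems.AnisotropyChordTransferFibre3FinXB2ThirtyTwo
import Summits.HubbardSuperconductivity.HubbardSuperconductivity.Theorems.AnisotropyChordTransferFibre3FinXB2ThirtyThree
import Summits.HubbardSuperconductivity.HubbardSuperconductivity.Theorems.AnisotropyChordTransferFibre3FinXB2ThirtyFour
import Summits.HubbardSuperconductivity.HubbardSuperconductivity.Theorems.AnisotropyChordTransferFibre3FinXB2ThirtyFive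
import Summits.HubbardSuperconductivity.HubbardSuperconductivity.Theorems.AnisotropyChordTransferFibre3FinXB2ThirtySix
import Summits.HubbardSuperconductivity.HubbardSuperconductivity.Theorems.AnisotropyChordTransferFibre3FinXB2ThirtySeven
import Summits.HubbardSuperconductivity.HubbardSuperconductivity.Theorems.AnisotropyChordTransferFibre3FinXB2ThirtyEight
import Summits.HubbardSuperconductivity.HubbardSuperconductivity.Theorems.AnisotropyChordTransferFibre3FinXB2ThirtyNine
import Summits.HubbardSuperconductivity.HubbardSuperconductivity.Theorems.AnisotropyChordTransferFibre3FinXB2Forty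
import Summits.HubbardSuperconductivity.HubbardSuperconductivity.Theorems.AnisotropyChordTransferFibre3FinXB2FortyOne
import Summits.HubbardSuperconductivity.HubbardSuperconductivity.Theorems.AnisotropyChordTransferFibre3FinXB2FortyTwo
import Summits.HubbardSuperconductivity.HubbardSuperconductivity.Theorems.AnisotropyChordTransferFibre3FinXB2FortyThree
import Summits.HubbardSuperconductivity.HubbardSuperconductivity.Theorems.AnisotropyChordTransferFibre3FinXB2FortyFour
import Summits.HubbardSuperconductivity.HubbardSuperconductivity.Theorems.AnisotropyChordTransferFibre3FinXB2FortyFive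
import Summits.HubbardSuperconductivity.HubbardSuperconductivity.Theorems.AnisotropyChordTransferFibre3FinXB2FortySix
import Summits.HubbardSuperconductivity.HubbardSuperconductivity.Theorems.AnisotropyChordTransferFibre3FinXB2FortySeven

/-!
# Route `AnisotropyChord` / H0 rotor rung: ★★ ROW `N₁` (KT-1″) FOR EVERY `9 ≤ L ≤ 47`, `0 < Δ ≤ 0.98` (FIN-class, kernel-certified)

Packaging of the per-`L` row-`N₁` certificates: g5's exact-block certificates `trialGapAbs_nine … trialGapAbs_twentyfour`
(`…FinXB<Word>`, constants `3/10 … 9/20`) and g6's XB2 certificates `trialGapAbs_twentyfive … trialGapAbs_fortyseven`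
(`…FinXB2<Word>`, constant `2/5`) into ONE statement with the uniform constant `3/10`:
`trialGapAbs_of_le_47 : 9 ≤ L → L ≤ 47 → 0 < Δ → Δ ≤ 0.98 → TrialGapAbs L Δ (3/10)` (`interval_cases`; `trialGapAbs_mono`:
the constant of `TrialGapAbs` can be lowered since `U = 3V²T⁺ > 0`).  The per-`L` / per-cell constants remain available in the
per-`L` files.  The block `L ≥ 48` is the t-block / `L ≥ 128` programme (p1/p2); the strip `0.98 < Δ < 1` is ruling R3.
Prover seat `hubbard-h0-rotor-p3` g6; helper for piece A = stmt-HubbardSuperconductivity-23918 of rung 19089 (`--supports`, helper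
class).  WHAT THIS IS NOT: nothing here proves superconductivity in the Hubbard model (rotor TARGET as worded stays FALSE, g15 verdict);
ONE hypothesis (row `N₁`) of ONE conditional reduction (`gm3_allL`) on a finite range of `L`.  Tree imports only; no sorry, no new axioms.
-/

set_option linter.dupNamespace false
set_option autoImplicit false

namespace Summit.HubbardSuperconductivity.HubbardSuperconductivity.Theorems.AnisotropyChord.Transfer.Fibre3

/-- the constant of `TrialGapAbs` can be lowered (`U = 3V²T⁺ > 0` for a ground profile at `Δ < 1`). [folklore] -/
theorem trialGapAbs_mono (L : ℕ) [NeZero L] (hL : 2 ≤ L) {Δ : ℝ} {c c' : ℝ} (hc : c' ≤ c) (hΔ1 : Δ < 1)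
    (h : TrialGapAbs L Δ c) : TrialGapAbs L Δ c' := by
  intro lam2 f hf
  have hU : 0 < Uunit L Δ f := by
    unfold Uunit
    have hT := Tplus_pos L hL hΔ1 hf
    have hLpos : (0 : ℝ) < L := by exact_mod_cast (show 0 < L by omega)
    positivity
  exact (mul_le_mul_of_nonneg_right hc hU.le).trans (h lam2 f hf)

/-- ★★ ROW `N₁` (KT-1″) FOR EVERY `9 ≤ L ≤ 47`: `N₁ ≥ (3/10)·3V²T⁺` for every ground two-magnon profile at `0 < Δ ≤ 0.98`
(FIN-class, kernel-certified with zero data; 39 per-`L` certificates). [folklore] -/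
theorem trialGapAbs_of_le_47 (L : ℕ) [NeZero L] (h9 : 9 ≤ L) (h47 : L ≤ 47) {Δ : ℝ} (hΔ0 : 0 < Δ) (hΔ1 : Δ ≤ 0.98) :
    TrialGapAbs L Δ (3 / 10) := by
  have hΔ1' : Δ < 1 := by linarith
  interval_cases L
  · exact trialGapAbs_mono 9 (by norm_num) (by norm_num) hΔ1' (trialGapAbs_nine hΔ0 hΔ1)
  · exact trialGapAbs_mono 10 (by norm_num) (by norm_num) hΔ1' (trialGapAbs_ten hΔ0 hΔ1)
  · exact trialGapAbs_mono 11 (by norm_num) (by norm_num) hΔ1' (trialGapAbs_eleven hΔ0 hΔ1)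
  · exact trialGapAbs_mono 12 (by norm_num) (by norm_num) hΔ1' (trialGapAbs_twelve hΔ0 hΔ1)
  · exact trialGapAbs_mono 13 (by norm_num) (by norm_num) hΔ1' (trialGapAbs_thirteen hΔ0 hΔ1)
  · exact trialGapAbs_mono 14 (by norm_num) (by norm_num) hΔ1' (trialGapAbs_fourteen hΔ0 hΔ1)
  · exact trialGapAbs_mono 15 (by norm_num) (by norm_num) hΔ1' (trialGapAbs_fifteen hΔ0 hΔ1)
  · exact trialGapAbs_mono 16 (by norm_num) (by norm_num) hΔ1' (trialGapAbs_sixteen hΔ0 hΔ1)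
  · exact trialGapAbs_mono 17 (by norm_num) (by norm_num) hΔ1' (trialGapAbs_seventeen hΔ0 hΔ1)
  · exact trialGapAbs_mono 18 (by norm_num) (by norm_num) hΔ1' (trialGapAbs_eighteen hΔ0 hΔ1)
  · exact trialGapAbs_mono 19 (by norm_num) (by norm_num) hΔ1' (trialGapAbs_nineteen hΔ0 hΔ1)
  · exact trialGapAbs_mono 20 (by norm_num) (by norm_num) hΔ1' (trialGapAbs_twenty hΔ0 hΔ1)
  · exact trialGapAbs_mono 21 (by norm_num) (by norm_num) hΔ1' (trialGapAbs_twentyone hΔ0 hΔ1)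
  · exact trialGapAbs_mono 22 (by norm_num) (by norm_num) hΔ1' (trialGapAbs_twentytwo hΔ0 hΔ1)
  · exact trialGapAbs_mono 23 (by norm_num) (by norm_num) hΔ1' (trialGapAbs_twentythree hΔ0 hΔ1)
  · exact trialGapAbs_mono 24 (by norm_num) (by norm_num) hΔ1' (trialGapAbs_twentyfour hΔ0 hΔ1)
  · exact trialGapAbs_mono 25 (by norm_num) (by norm_num) hΔ1' (trialGapAbs_twentyfive hΔ0 hΔ1)
  · exact trialGapAbs_mono 26 (by norm_num) (by norm_num) hΔ1' (trialGapAbs_twentysix hΔ0 hΔ1)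
  · exact trialGapAbs_mono 27 (by norm_num) (by norm_num) hΔ1' (trialGapAbs_twentyseven hΔ0 hΔ1)
  · exact trialGapAbs_mono 28 (by norm_num) (by norm_num) hΔ1' (trialGapAbs_twentyeight hΔ0 hΔ1)
  · exact trialGapAbs_mono 29 (by norm_num) (by norm_num) hΔ1' (trialGapAbs_twentynine hΔ0 hΔ1)
  · exact trialGapAbs_mono 30 (by norm_num) (by norm_num) hΔ1' (trialGapAbs_thirty hΔ0 hΔ1)
  · exact trialGapAbs_mono 31 (by norm_num) (by norm_num) hΔ1' (trialGapAbs_thirtyone hΔ0 hΔ1)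
  · exact trialGapAbs_mono 32 (by norm_num) (by norm_num) hΔ1' (trialGapAbs_thirtytwo hΔ0 hΔ1)
  · exact trialGapAbs_mono 33 (by norm_num) (by norm_num) hΔ1' (trialGapAbs_thirtythree hΔ0 hΔ1)
  · exact trialGapAbs_mono 34 (by norm_num) (by norm_num) hΔ1' (trialGapAbs_thirtyfour hΔ0 hΔ1)
  · exact trialGapAbs_mono 35 (by norm_num) (by norm_num) hΔ1' (trialGapAbs_thirtyfive hΔ0 hΔ1)
  · exact trialGapAbs_mono 36 (by norm_num) (by norm_num) hΔ1' (trialGapAbs_thirtysix hΔ0 hΔ1)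
  · exact trialGapAbs_mono 37 (by norm_num) (by norm_num) hΔ1' (trialGapAbs_thirtyseven hΔ0 hΔ1)
  · exact trialGapAbs_mono 38 (by norm_num) (by norm_num) hΔ1' (trialGapAbs_thirtyeight hΔ0 hΔ1)
  · exact trialGapAbs_mono 39 (by norm_num) (by norm_num) hΔ1' (trialGapAbs_thirtynine hΔ0 hΔ1)
  · exact trialGapAbs_mono 40 (by norm_num) (by norm_num) hΔ1' (trialGapAbs_forty hΔ0 hΔ1)
  · exact trialGapAbs_mono 41 (by norm_num) (by norm_num) hΔ1' (trialGapAbs_fortyone hΔ0 hΔ1)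
  · exact trialGapAbs_mono 42 (by norm_num) (by norm_num) hΔ1' (trialGapAbs_fortytwo hΔ0 hΔ1)
  · exact trialGapAbs_mono 43 (by norm_num) (by norm_num) hΔ1' (trialGapAbs_fortythree hΔ0 hΔ1)
  · exact trialGapAbs_mono 44 (by norm_num) (by norm_num) hΔ1' (trialGapAbs_fortyfour hΔ0 hΔ1)
  · exact trialGapAbs_mono 45 (by norm_num) (by norm_num) hΔ1' (trialGapAbs_fortyfive hΔ0 hΔ1)
  · exact trialGapAbs_mono 46 (by norm_num) (by norm_num) hΔ1' (trialGapAbs_fortysix hΔ0 hΔ1)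
  · exact trialGapAbs_mono 47 (by norm_num) (by norm_num) hΔ1' (trialGapAbs_fortyseven hΔ0 hΔ1)

end Summit.HubbardSuperconductivity.HubbardSuperconductivity.Theorems.AnisotropyChord.Transfer.Fibre3
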